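import Literature.MathematicalPhysics.QuantumFieldTheory.Balaban1983to89.T3SectALandauChart
import Literature.MathematicalPhysics.QuantumFieldTheory.Balaban1983to89.B11Eq135Weitzenbock
import Literature.MathematicalPhysics.QuantumFieldTheory.Balaban1983to89.B11Thm1LevelZero
import HarnessLib

/-!
# Route `UnitScaleTilt`, crux «MinimiserStabilityRegPr» (stmt-QuantumFields-19200, stub EX, route (α)) — THE ORDER-2 DICTIONARY AT THE T³ OBJECTS:
# the second-order members `D¹*_{U₀}D¹_{U₀}X`, `Δ¹_{U₀}X` of the (19)-size `nMax19` (`T3SectALandauChart.covCodiffCurlT`∕`covLapFormT` at `bgUnits U₀`)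
# ARE the lattice operators of [Balaban1985BackgroundPropagators] §A (`B9Eq39Adjoint.divP ∘ curl`, `B11Eq135Weitzenbock.vecLap`) on the torus of record,
# and [Balaban1985Variational] (135) — the exact-background Weitzenböck identity `D*D + DD* = Δ_{U₀} − 𝒦` — IN THE `nMax19` LETTERS, with the (14)-clause
# bound `‖𝒦X‖ ≤ 2(d − 1)·δ·sup‖X‖` under `PlaqSmall δ U₀`

Cell `ym3-torus` (HUMAN RULING D-0037, YM ladder rung R3 — YM₃ on T³, NOT d = 4, NOT the Clay problem; the YM mass gap is NOT proved here), width seat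
`ym3-torus-px16` (FILL-TO-CAP «width 16»; explicit-unit; `--supports stmt-QuantumFields-19200 --as helper`, count-neutral; NO claim on the crux, a stub or
the registry).  THEOREMS ONLY (0 `def`, 0 `sorry`).  Row «`hDict2`» of the LOCATE `LOCATE-HDSOL-136-px16.md` (19200 evidence #52) §2: the dictionary both
second-order (S)-supplier sub-rows of ★★OWNER RULING g27-№7 (3) — `hΔsol` ([Balaban1985Variational] (136)) and `hΔH` ((137)–(140)) — need to read their
`|·|₍₋₃₎`-conclusions into the two second-order members of `Prop7TPrint.nMax19` (desk ym-inputs g15-1 (3) ∕ p04 g5 evidence #49: «an order-2 dictionary nobody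
has»; `rg covLapFormT|covCodiffCurlT` = 0∕100 `…Prop7SectET3*.lean` at 2026-08-28T16:24Z).

THE PRINT.  [Balaban1985Variational] (19) p. 281: *«U₁ = e^{iηA}, |A| < ε₂(Lʲη)⁻¹, |∇^η_{U₀}A| < ε₂(Lʲη)⁻², |D^{η*}_{U₀}D^η_{U₀}A|, |Δ^η_{U₀}A| < ε₂(Lʲη)⁻³ on Ω_j»*;
(135) p. 298: *«(D*DA₀)_μ(x) + (DD*A₀)_μ(x) = (Δ_{U₀}A₀,μ)(x) − Σ_{ν=1}^{d} R(U₀(x, x + ηe_μ)U₀(x + ηe_μ, x + ηe_μ − ηe_ν))·η⁻²[R(U₀(∂p′_μν(x))) − 1]A_ν(x + ηe^ν),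
where p′_μν(x) = ⟨x + ηe_μ − ηe_ν, x + ηe_μ, x, x − ηe_ν⟩ … This way we have expressed (Δ + DRD*)A₀ as a sum of Δ_{U₀}A₀ and a bounded operator acting on A₀.
The bound for this operator follows from … the regularity condition (14) for the configuration U₀.»*; p. 299 (140): *«we use again the formula (135)»*.
[Balaban1985BackgroundPropagators] (3.3), (3.4), (3.8), (3.9) pp. 390–392 (the operators `D_μ`, `D_U`, `D*_μ`, `D*` of §A), (3.23) p. 394 (`Δ_U = Σ_μ D*_{U,μ}D_{U,μ}`).

WHAT IS PROVED (sorry-free, no definition; nothing of print asserted beyond the kernel-checked identity (135), which lit-balaban's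
`B11Eq135Weitzenbock.eq135_torus` ALREADY proves on the torus of record — this file only READS it in the route's letters).
* §1 THE DICTIONARY (`V : GaugeField P s 𝔸ˣ` any background of units of a normed ℂ-algebra, `X : PBond P s → 𝔸` any one-form; the lit-balaban
  lattice is `(S, T, U) := (Site P s, B9TorusCalculus.torusT P s, fun μ x ↦ V ⟨x, μ⟩)`, the bond field `A := T3SectALandauChart.formComp X`):
  (`conjR = B9Eq39Adjoint.R` is lit ✓`B9B8CarrierDictionary.conjR_eq_R`, definitional) `covDerivFwdT η = η⁻¹•covD` · `covDerivT η = η⁻¹•covDstar` · at `η = 1`: `covGradT = covD ∘ formComp`, `covCurlT = curl`,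
  `covCodiffT = divP`, **`covCodiffCurlT 1 V X = divP (curl A)`**, **`covLapFormT 1 V X = vecLap A`**, `covDivFormT 1 V X = divB A`,
  `covDerivFwdT 1 V μ (covDivFormT 1 V X) = covD μ (divB A)`; and the plaquette letters `plaqU (torusT) U μ ν x = holT V x (plaqWord μ ν)`, `= plaqFT V μ ν x` in `𝔸`.
* §2 **(135) IN THE `nMax19` LETTERS** (★`covCodiffCurlT_add_gradDiv_eq`): for EVERY background and one-form,
  `covCodiffCurlT 1 V X μ x + covDerivFwdT 1 V μ (covDivFormT 1 V X) x = covLapFormT 1 V X μ x − curvOp (torusT P s) U A μ x`, i.e.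
  `D¹*D¹_{U₀}X + D¹D¹*_{U₀}X = Δ¹_{U₀}X − 𝒦X` (and the rearranged form `covCodiffCurlT = covLapFormT − D(D*X) − 𝒦X`).
* §3 THE (14)-CLAUSE BOUND AT THE T³ OBJECTS: `‖𝒦X‖ ≤ 2(d−1)·δ·a` for unit-norm bond variables with `‖V(∂p) − 1‖ ≤ δ` (`norm_curvOp_formComp_le`, =
  lit `norm_curvOp_le` read through §1), hence for an `SU(2)` background `U₀` of the route with `PlaqSmall δ U₀` ([Balaban1985Variational] (2)∕(14)):
  ★★`norm_covCodiffCurlT_sub_covLapFormT_add_gradDiv_le` — `‖D¹*D¹X − (Δ¹X − D¹(D¹*X))‖ ≤ 2(d−1)·δ·a` at `bgUnits F K U₀` whenever `‖X b‖ ≤ a`; and on the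
  printed-regular class `RegPr F n K ε₀ U₀` (`δ = ε₀·η²`, `η = L^{−(K−n)}`, `d = 3`): ★★`…_of_regPr` with right side `4·ε₀·η²·a`.
So a supplier who proves a bound for ONE of the two second-order members of (19) (print proves (136) for `Δ_{U₀}` and converts at (140)) gets the other
modulo the gradient-of-divergence term `D¹(D¹*X)` (zero in the Landau gauge up to the projected part, [Balaban1985Variational] (21)) and an `O(ε₀η²)·sup‖X‖` error.

HONEST SCOPE.  Bookkeeping between two typed letter systems + one kernel-checked identity of lit-balaban read at the member + one triangle inequality; no
estimate of [Balaban1985BackgroundPropagators] §3 ((3.42), (3.49), (3.69), (3.137)) and nothing of (136)∕(137)–(140) is proved or claimed; `nMax19` itself is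
not touched.  Not a proof of any stub; nothing continuum ∕ OS ∕ mass-gap ∕ Clay.

References: T. Bałaban, CMP **102** (1985) 277–309 [Balaban1985Variational] ((19) p.281, (2) p.278, (14) p.280, (21) p.281, (134)–(136) p.298, (140) p.299);
CMP **99** (1985) 389–434 [Balaban1985BackgroundPropagators] ((3.3)–(3.9) pp.390–392, (3.23) p.394); CMP **99** (1985) 75–102 [Balaban1985RegularSpaces]
((1.1)–(1.2) p.76, (1.39) p.83); CMP **98** (1985) 17–51 [Balaban1985Averaging] ((9) p.19, (19) p.21).
-/

set_option autoImplicit false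

noncomputable section

open scoped Matrix.Norms.L2Operator

namespace Summit.QuantumFields.YangMills.Theorems.Prop7SecondOrderDict

open Literature.MathematicalPhysics.QuantumFieldTheory.Balaban1983to89
open Literature.MathematicalPhysics.QuantumFieldTheory.Balaban1983to89.T3ContinuumYM3Torus
open Literature.MathematicalPhysics.QuantumFieldTheory.Balaban1983to89.T3PrintedRegularMinimiser (RegPr)
open Literature.MathematicalPhysics.QuantumFieldTheory.Balaban1983to89.T3RegularMinimiser (regThreshold)
open T3SectALandauChart (covDerivFwdT formComp covGradT covCurlT covCodiffT covCodiffCurlT covLapFormT covDivFormT bgUnits eta eta_pos)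
open B10Eq68TorusRegularity (plaqFT covDerivT)
open B7Eq78Linearization (conjR)
open B7Prop1Explicit (plaqWord U1)
open B7Prop2Explicit (unitaryUnits unitaryUnits_le_U1)
open B10Eq27TorusAxialLog (holT unitsField toUField holT_plaqWord unitsField_mem_unitaryUnits)
open B9Eq39Adjoint (R covD covDstar curl divB divP plaqU)
open B11Eq135Weitzenbock (vecLap curvOp hodgeOp)
open B9TorusCalculus (torusT torusT_apply torusT_symm_apply torusT_comm)

/-! ## §1 The dictionary `T3SectALandauChart` §2 ↔ `B9Eq39Adjoint` on the torus of record -/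

section Dictionary

variable {P : Params} {s : ℕ} {𝔸 : Type*} [NormedRing 𝔸] [NormedAlgebra ℂ 𝔸]

/-- **(1.1) forward = (3.3)**: `covDerivFwdT η V μ = η⁻¹ • D_{U,μ}` with `U μ x = V ⟨x, μ⟩`, shifts `torusT`. [cite: Balaban1985RegularSpaces, (1.1) p.76; Balaban1985BackgroundPropagators, (3.3) p.390] -/
theorem covDerivFwdT_eq_smul_covD (η : ℝ) (V : GaugeField P s 𝔸ˣ) (μ : Fin P.d) (G : Site P s → 𝔸) (x : Site P s) :
    covDerivFwdT η V μ G x = η⁻¹ • covD (torusT P s) (fun μ x => V ⟨x, μ⟩) μ G x := rfl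

/-- **(1.1) backward = (3.8)'s `D*_μ`**: `covDerivT η V μ = η⁻¹ • D*_{U,μ}`. [cite: Balaban1985RegularSpaces, (1.1) p.76; Balaban1985BackgroundPropagators, (3.8) p.392] -/
theorem covDerivT_eq_smul_covDstar (η : ℝ) (V : GaugeField P s 𝔸ˣ) (μ : Fin P.d) (G : Site P s → 𝔸) (x : Site P s) :
    covDerivT η V μ G x = η⁻¹ • covDstar (torusT P s) (fun μ x => V ⟨x, μ⟩) μ G x := rfl

/-- `covDerivFwdT 1 = D¹_{U,μ}`. [cite: Balaban1985BackgroundPropagators, (3.3) p.390] -/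
theorem covDerivFwdT_one_eq (V : GaugeField P s 𝔸ˣ) (μ : Fin P.d) (G : Site P s → 𝔸) (x : Site P s) :
    covDerivFwdT 1 V μ G x = covD (torusT P s) (fun μ x => V ⟨x, μ⟩) μ G x := by
  rw [covDerivFwdT_eq_smul_covD, inv_one, one_smul]

/-- `covDerivT 1 = D¹*_{U,μ}`. [cite: Balaban1985BackgroundPropagators, (3.8) p.392] -/
theorem covDerivT_one_eq (V : GaugeField P s 𝔸ˣ) (μ : Fin P.d) (G : Site P s → 𝔸) (x : Site P s) :
    covDerivT 1 V μ G x = covDstar (torusT P s) (fun μ x => V ⟨x, μ⟩) μ G x := by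
  rw [covDerivT_eq_smul_covDstar, inv_one, one_smul]

/-- The covariant gradient entry `(∇¹_U X)_{μν} = D¹_μ X_ν`. [cite: Balaban1985Variational, (19) p.281; Balaban1985BackgroundPropagators, (3.3) p.390] -/
theorem covGradT_one_eq (V : GaugeField P s 𝔸ˣ) (X : PBond P s → 𝔸) (μ ν : Fin P.d) (x : Site P s) :
    covGradT 1 V X μ ν x = covD (torusT P s) (fun μ x => V ⟨x, μ⟩) μ (formComp X ν) x :=
  covDerivFwdT_one_eq V μ _ x

/-- **The covariant curl = (3.4)**: `covCurlT 1 V X = curl (formComp X)` as plaquette functions. [cite: Balaban1985BackgroundPropagators, (3.4) p.391; Balaban1985RegularSpaces, (1.47) p.84] -/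
theorem covCurlT_one_eq (V : GaugeField P s 𝔸ˣ) (X : PBond P s → 𝔸) :
    covCurlT 1 V X = curl (torusT P s) (fun μ x => V ⟨x, μ⟩) (formComp X) := by
  funext μ ν x
  simp only [covCurlT, covGradT_one_eq, curl]

/-- **The codifferential (1.2) = (3.9)**: `covCodiffT 1 V F = divP F` (first form of (3.9), the `ν < μ` ∕ `ν > μ` split). [cite: Balaban1985RegularSpaces, (1.2) p.76; Balaban1985BackgroundPropagators, (3.9) p.392] -/
theorem covCodiffT_one_eq (V : GaugeField P s 𝔸ˣ) (Fp : Fin P.d → Fin P.d → Site P s → 𝔸) (μ : Fin P.d) (x : Site P s) :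
    covCodiffT 1 V Fp μ x = divP (torusT P s) (fun μ x => V ⟨x, μ⟩) Fp μ x := by
  simp only [covCodiffT, divP, covDerivT_one_eq, Finset.sum_ite, Finset.sum_const_zero, add_zero,
    Finset.filter_gt_eq_Iio, Finset.filter_lt_eq_Ioi]

/-- ★ **THE FIRST SECOND-ORDER MEMBER OF (19)**: `D¹*_{U}D¹_{U}X = divP (curl (formComp X))` — `covCodiffCurlT 1 V X` IS [5]'s `D*D_U` applied to the
one-form. [cite: Balaban1985Variational, (19) p.281; Balaban1985BackgroundPropagators, (3.4), (3.9) pp.391–392] -/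
theorem covCodiffCurlT_one_eq (V : GaugeField P s 𝔸ˣ) (X : PBond P s → 𝔸) (μ : Fin P.d) (x : Site P s) :
    covCodiffCurlT 1 V X μ x
      = divP (torusT P s) (fun μ x => V ⟨x, μ⟩) (curl (torusT P s) (fun μ x => V ⟨x, μ⟩) (formComp X)) μ x := by
  rw [covCodiffCurlT, covCurlT_one_eq, covCodiffT_one_eq]

/-- ★ **THE SECOND SECOND-ORDER MEMBER OF (19)**: `Δ¹_U X_ν = Σ_μ D¹*_μD¹_μX_ν = vecLap (formComp X) ν` — `covLapFormT 1 V X` IS the componentwise covariant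
Laplacian (3.23) of [5] (`B11Eq135Weitzenbock.vecLap`). [cite: Balaban1985Variational, (19) p.281; Balaban1985BackgroundPropagators, (3.23) p.394] -/
theorem covLapFormT_one_eq (V : GaugeField P s 𝔸ˣ) (X : PBond P s → 𝔸) (ν : Fin P.d) (x : Site P s) :
    covLapFormT 1 V X ν x = vecLap (torusT P s) (fun μ x => V ⟨x, μ⟩) (formComp X) ν x := by
  simp only [covLapFormT, vecLap, covDerivT_one_eq]
  refine Finset.sum_congr rfl fun μ _ => ?_
  congr 1
  funext y
  exact covDerivFwdT_one_eq V μ _ y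

/-- **The covariant divergence of a one-form = (3.8)'s `D*`**: `covDivFormT 1 V X = divB (formComp X)`. [cite: Balaban1985Variational, (21) p.281; Balaban1985BackgroundPropagators, (3.8) p.392] -/
theorem covDivFormT_one_eq (V : GaugeField P s 𝔸ˣ) (X : PBond P s → 𝔸) :
    covDivFormT 1 V X = divB (torusT P s) (fun μ x => V ⟨x, μ⟩) (formComp X) := by
  funext x
  simp only [covDivFormT, divB, covDerivT_one_eq]

/-- The gradient of the divergence, `(D¹D¹*X)_μ(x) = D¹_μ(D¹*X)(x)`, in both letter systems. [cite: Balaban1985Variational, (135) p.298] -/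
theorem covDerivFwdT_covDivFormT_one_eq (V : GaugeField P s 𝔸ˣ) (X : PBond P s → 𝔸) (μ : Fin P.d) (x : Site P s) :
    covDerivFwdT 1 V μ (covDivFormT 1 V X) x
      = covD (torusT P s) (fun μ x => V ⟨x, μ⟩) μ (divB (torusT P s) (fun μ x => V ⟨x, μ⟩) (formComp X)) x := by
  rw [covDerivFwdT_one_eq, covDivFormT_one_eq]

omit [NormedAlgebra ℂ 𝔸] in
/-- The plaquette variable of [5] (3.1) on the torus of record IS the transport of the plaquette word `(+e_μ, +e_ν, −e_μ, −e_ν)`: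
`plaqU (torusT) U μ ν x = V(x,x+e_μ)V(x+e_μ,x+e_μ+e_ν)V(x+e_ν,x+e_μ+e_ν)⁻¹V(x,x+e_ν)⁻¹ = holT V x (plaqWord μ ν)`. [cite: Balaban1985Averaging, (9) p.19; Balaban1985BackgroundPropagators, (3.1) p.390] -/
theorem plaqU_torusT_eq_holT (V : GaugeField P s 𝔸ˣ) (μ ν : Fin P.d) (x : Site P s) :
    plaqU (torusT P s) (fun μ x => V ⟨x, μ⟩) μ ν x = holT V x (plaqWord μ ν) := by
  rw [holT_plaqWord]
  rfl

omit [NormedAlgebra ℂ 𝔸] in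
/-- … read in `𝔸`: `↑(plaqU (torusT) U μ ν x) = plaqFT V μ ν x` (`B10Eq68TorusRegularity.plaqFT`). [cite: Balaban1985Averaging, (9) p.19] -/
theorem val_plaqU_torusT_eq_plaqFT (V : GaugeField P s 𝔸ˣ) (μ ν : Fin P.d) (x : Site P s) :
    ((plaqU (torusT P s) (fun μ x => V ⟨x, μ⟩) μ ν x : 𝔸ˣ) : 𝔸) = plaqFT V μ ν x := by
  rw [plaqU_torusT_eq_holT]
  rfl

end Dictionary

/-! ## §2 [Balaban1985Variational] (135) in the `nMax19` letters -/

section Weitzenbock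

variable {P : Params} {s : ℕ} {𝔸 : Type*} [NormedRing 𝔸] [NormedAlgebra ℂ 𝔸]

/-- ★ **(135) AT THE T³ OBJECTS, unit lattice, EVERY background of units and every one-form**:
`(D¹*D¹_{U₀}X)_μ(x) + (D¹D¹*_{U₀}X)_μ(x) = (Δ¹_{U₀}X)_μ(x) − (𝒦X)_μ(x)` with `𝒦 = B11Eq135Weitzenbock.curvOp` the printed curvature operator
`Σ_ν R(U₀(x,x+e_μ)U₀(x+e_μ,x+e_μ−e_ν))[R(U₀(∂p′_μν(x))) − 1]A_ν(x+e_μ−e_ν)` — lit-balaban's `eq135_torus` read through §1.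
[cite: Balaban1985Variational, (135) p.298] -/
theorem covCodiffCurlT_add_gradDiv_eq (V : GaugeField P s 𝔸ˣ) (X : PBond P s → 𝔸) (μ : Fin P.d) (x : Site P s) :
    covCodiffCurlT 1 V X μ x + covDerivFwdT 1 V μ (covDivFormT 1 V X) x
      = covLapFormT 1 V X μ x - curvOp (torusT P s) (fun μ x => V ⟨x, μ⟩) (formComp X) μ x := by
  rw [covCodiffCurlT_one_eq, covDerivFwdT_covDivFormT_one_eq, covLapFormT_one_eq, ← B11Eq135Weitzenbock.hodgeOp_def]
  exact B11Eq135Weitzenbock.eq135_torus _ _ μ x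

/-- (135) rearranged for the first member: `D¹*D¹_{U₀}X = Δ¹_{U₀}X − D¹(D¹*_{U₀}X) − 𝒦X`. [cite: Balaban1985Variational, (135) p.298, (140) p.299] -/
theorem covCodiffCurlT_eq_covLapFormT_sub (V : GaugeField P s 𝔸ˣ) (X : PBond P s → 𝔸) (μ : Fin P.d) (x : Site P s) :
    covCodiffCurlT 1 V X μ x
      = covLapFormT 1 V X μ x - covDerivFwdT 1 V μ (covDivFormT 1 V X) x
          - curvOp (torusT P s) (fun μ x => V ⟨x, μ⟩) (formComp X) μ x := by
  rw [sub_right_comm, ← covCodiffCurlT_add_gradDiv_eq V X μ x, add_sub_cancel_right]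

/-- (135) rearranged for the second member: `Δ¹_{U₀}X = D¹*D¹_{U₀}X + D¹(D¹*_{U₀}X) + 𝒦X`. [cite: Balaban1985Variational, (135) p.298] -/
theorem covLapFormT_eq_covCodiffCurlT_add (V : GaugeField P s 𝔸ˣ) (X : PBond P s → 𝔸) (μ : Fin P.d) (x : Site P s) :
    covLapFormT 1 V X μ x
      = covCodiffCurlT 1 V X μ x + covDerivFwdT 1 V μ (covDivFormT 1 V X) x
          + curvOp (torusT P s) (fun μ x => V ⟨x, μ⟩) (formComp X) μ x := by
  rw [covCodiffCurlT_add_gradDiv_eq V X μ x, sub_add_cancel]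

end Weitzenbock

/-! ## §3 The «regularity condition (14)» clause: the curvature operator is `O(δ)` on `PlaqSmall δ` backgrounds -/

section Bound

variable {P : Params} {s : ℕ} {𝔸 : Type*} [NormedRing 𝔸] [NormedAlgebra ℂ 𝔸]

omit [NormedAlgebra ℂ 𝔸] in
/-- `‖(𝒦X)_μ(x)‖ ≤ 2(d − 1)·δ·a` for a background of bond variables of norm `≤ 1` with inverses of norm `≤ 1` whose plaquette fields satisfy
`‖V(∂p_{μν}(y)) − 1‖ ≤ δ` (`μ ≠ ν`, both orientations) and a one-form with `‖X(b)‖ ≤ a` — lit-balaban's `norm_curvOp_le` read through §1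
(`Fintype.card (Fin d) = d`). [cite: Balaban1985Variational, (135)–(136) p.298, (14) p.280] -/
theorem norm_curvOp_formComp_le (V : GaugeField P s 𝔸ˣ) (hU1 : ∀ b : PBond P s, ‖(V b : 𝔸)‖ ≤ 1 ∧ ‖(((V b)⁻¹ : 𝔸ˣ) : 𝔸)‖ ≤ 1)
    {δ a : ℝ} (hP : ∀ (μ ν : Fin P.d) (y : Site P s), μ ≠ ν → ‖plaqFT V μ ν y - 1‖ ≤ δ)
    {X : PBond P s → 𝔸} (hX : ∀ b : PBond P s, ‖X b‖ ≤ a) (μ : Fin P.d) (x : Site P s) :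
    ‖curvOp (torusT P s) (fun μ x => V ⟨x, μ⟩) (formComp X) μ x‖ ≤ 2 * ((P.d : ℝ) - 1) * δ * a := by
  have h := B11Eq135Weitzenbock.norm_curvOp_le (torusT P s) (fun μ x => V ⟨x, μ⟩) torusT_comm (fun μ x => hU1 ⟨x, μ⟩)
    (δ := δ) (a := a) (fun μ ν y hne => by rw [val_plaqU_torusT_eq_plaqFT]; exact hP μ ν y hne)
    (A := formComp X) (fun ν y => hX ⟨y, ν⟩) μ x
  simpa only [Fintype.card_fin] using h

variable (F : T3Family) (n K : ℕ)

/-- For an `SU(2)`-valued background of run `K` read in `M₂(ℂ)` (`bgUnits`), the bond variables and their inverses have operator norm `≤ 1`.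
[cite: Balaban1985Averaging, (19) p.21] -/
theorem norm_bgUnits_le_one (U₀ : GaugeField (F.P K) 0 (Matrix.specialUnitaryGroup (Fin 2) ℂ)) (b : PBond (F.P K) 0) :
    ‖(bgUnits F K U₀ b : Matrix (Fin 2) (Fin 2) ℂ)‖ ≤ 1 ∧ ‖(((bgUnits F K U₀ b)⁻¹ : (Matrix (Fin 2) (Fin 2) ℂ)ˣ) : Matrix (Fin 2) (Fin 2) ℂ)‖ ≤ 1 := by
  letI : CStarAlgebra (Matrix (Fin 2) (Fin 2) ℂ) := B10Eq29TubeLine.cstarAlgebraMatrix 2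
  exact unitaryUnits_le_U1 (unitsField_mem_unitaryUnits (toUField U₀) b)

/-- `PlaqSmall δ U₀` gives `‖V(∂p) − 1‖ ≤ δ` for BOTH orientations of the plaquette field of `bgUnits U₀` (`B11Thm1LevelZero.norm_plaqFT_toUField_sub_one_lt`).
[cite: Balaban1985Variational, (2) p.278, (14) p.280] -/
theorem norm_plaqFT_bgUnits_sub_one_le (U₀ : GaugeField (F.P K) 0 (Matrix.specialUnitaryGroup (Fin 2) ℂ)) {δ : ℝ} (hU₀ : PlaqSmall δ U₀)
    (μ ν : Fin (F.P K).d) (y : Site (F.P K) 0) (hne : μ ≠ ν) :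
    ‖plaqFT (bgUnits F K U₀) μ ν y - 1‖ ≤ δ :=
  (B11Thm1LevelZero.norm_plaqFT_toUField_sub_one_lt U₀ hU₀ μ ν y hne).le

/-- ★★ **THE ORDER-2 DICTIONARY INEQUALITY AT THE T³ OBJECTS**: on a background `U₀` with `PlaqSmall δ U₀` and for a one-form `X` with `‖X b‖ ≤ a`,
`‖(D¹*D¹_{U₀}X)_μ(x) − ((Δ¹_{U₀}X)_μ(x) − (D¹D¹*_{U₀}X)_μ(x))‖ ≤ 2(d − 1)·δ·a` — the two second-order members of (19) ∕ `nMax19` differ by the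
gradient of the divergence and the (14)-small curvature operator. [cite: Balaban1985Variational, (19) p.281, (135)–(136) p.298, (140) p.299] -/
theorem norm_covCodiffCurlT_sub_covLapFormT_add_gradDiv_le (U₀ : GaugeField (F.P K) 0 (Matrix.specialUnitaryGroup (Fin 2) ℂ)) {δ : ℝ}
    (hU₀ : PlaqSmall δ U₀) {X : PBond (F.P K) 0 → Matrix (Fin 2) (Fin 2) ℂ} {a : ℝ} (hX : ∀ b, ‖X b‖ ≤ a)
    (μ : Fin (F.P K).d) (x : Site (F.P K) 0) :
    ‖covCodiffCurlT 1 (bgUnits F K U₀) X μ x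
        - (covLapFormT 1 (bgUnits F K U₀) X μ x - covDerivFwdT 1 (bgUnits F K U₀) μ (covDivFormT 1 (bgUnits F K U₀) X) x)‖
      ≤ 2 * (((F.P K).d : ℝ) - 1) * δ * a := by
  rw [covCodiffCurlT_eq_covLapFormT_sub, sub_sub_cancel_left, norm_neg]
  exact norm_curvOp_formComp_le (bgUnits F K U₀) (norm_bgUnits_le_one F K U₀) (norm_plaqFT_bgUnits_sub_one_le F K U₀ hU₀) hX μ x

/-- ★★ **… ON THE PRINTED-REGULAR CLASS** `RegPr F n K ε₀ U₀` ((14)∕(2): `|U₀(∂p) − 1| < ε₀L^{−2(K−n)} = ε₀η²`, `d = 3`):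
`‖D¹*D¹_{U₀}X − (Δ¹_{U₀}X − D¹(D¹*_{U₀}X))‖ ≤ 4·ε₀·η²·a` pointwise — the `O(ε₀η²)·sup‖X‖` price of exchanging the two second-order members of `nMax19`.
[cite: Balaban1985Variational, (14) p.280, (19) p.281, (135)–(136) p.298] -/
theorem norm_covCodiffCurlT_sub_covLapFormT_add_gradDiv_le_of_regPr {ε₀ : ℝ} (U₀ : GaugeField (F.P K) 0 (Matrix.specialUnitaryGroup (Fin 2) ℂ))
    (hU₀ : RegPr F n K ε₀ U₀) {X : PBond (F.P K) 0 → Matrix (Fin 2) (Fin 2) ℂ} {a : ℝ} (hX : ∀ b, ‖X b‖ ≤ a)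
    (μ : Fin (F.P K).d) (x : Site (F.P K) 0) :
    ‖covCodiffCurlT 1 (bgUnits F K U₀) X μ x
        - (covLapFormT 1 (bgUnits F K U₀) X μ x - covDerivFwdT 1 (bgUnits F K U₀) μ (covDivFormT 1 (bgUnits F K U₀) X) x)‖
      ≤ 4 * ε₀ * eta F n K ^ 2 * a := by
  have h := norm_covCodiffCurlT_sub_covLapFormT_add_gradDiv_le F K U₀ hU₀.plaqSmall hX μ x
  have hd : (((F.P K).d : ℝ) - 1) = 2 := by rw [T3Family.P_d]; norm_num
  have hη : regThreshold F n K ε₀ = ε₀ * eta F n K ^ 2 := by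
    rw [regThreshold, eta, ← pow_mul, mul_comm 2 (K - n)]
  rw [hd, hη] at h
  linarith

end Bound

end Summit.QuantumFields.YangMills.Theorems.Prop7SecondOrderDict

end
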